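import Summits.Ventures.CertifiedManyBodySolver.Certificates.S2Rm2uTierP.Head
import Summits.Ventures.CertifiedManyBodySolver.Certificates.S2Rm2uTierP.Hints007
import Summits.Ventures.CertifiedManyBodySolver.Rows.CorrWindowCertKernelChainQuotAdjFastBox

/-!
# tier-P instance (S2Rm2u-R13-W3) — chain forest segment 25 of 103 (steps 94..95 from `[]`), file 1 of 1: steps 94..95 (topology (B): eval%-chained accumulators, import-serial INSIDE the segment only)

Generated by hubbard-algo-p2's untrusted exporter (emit_v0.py + emit_w3.py); every datum below is re-derived / re-checked by the kernel chain
(`stepEQA`, Rows/CorrWindowCertKernelChainQuotAdj.lean) or is inert. HONEST FRAMING (xx1): instance data / kernel replay of a CONTROL/CALIBRATION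
certificate (S2′-Rm2-u″ OVERHANG pinned spoke of the La214-E t′-pair {S2′ −357/740, hub′ −3/10}: t′ = −357/740, CORNER objective t′_X = −3/10, eom multipliers PINNED to the hub-Rm2-u′ certificate (EB by name), sdp-1 (R1) C-edition j326976, 4^40-dyadic two-level Gram factors); nothing here is a theorem about the Hubbard model; no summit statement. [cite: Han2020Bootstrap, §3]
-/

set_option linter.style.longLine false
set_option maxRecDepth 100000
set_option maxHeartbeats 0

namespace Summit.Ventures.CertifiedManyBodySolver
namespace CARPolyWindow.TierP.S2Rm2u
open Summit.Ventures.CertifiedQuantumChemistry Summit.Ventures.CertifiedQuantumChemistry.CARPoly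
open Literature.MathematicalPhysics.QuantumLattice Literature.MathematicalPhysics.QuantumLattice.HubbardWave0
open Literature.Probability.LatticeModels
open CARPolyWindow CARPolyWindow.BoxGeom

/-- segment 25 starts from the EMPTY accumulator before step 94 (chain forest, R-g4-11 (L6)). [folklore] -/
def C25_0 : SOSDual.EncPoly := []

/-- accumulator after step 95 within segment 25 (evaluated at elaboration; the kernel re-derives it in `step_94`). [folklore] -/
def C25_1 : SOSDual.EncPoly := eval% stepEQA D 2048 C25_0 (slices.getD 94 []) (hintsOfCodes Dr reps HC94)

/-- KERNEL FACT, step 94 of 350 (fast step (L7): `stepEQAFB_kernel`, box edition). [folklore] -/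
theorem step_94 : C25_1 = stepEQA D 2048 C25_0 (slices.getD 94 []) (hintsOfCodes Dr reps HC94) :=
  stepEQAFB_kernel 6 13 7 rfl (by decide +kernel)

/-- accumulator after step 96 within segment 25 (evaluated at elaboration; the kernel re-derives it in `step_95`). [folklore] -/
def C25_2 : SOSDual.EncPoly := eval% stepEQA D 2048 C25_1 (slices.getD 95 []) (hintsOfCodes Dr reps HC95)

/-- KERNEL FACT, step 95 of 350 (fast step (L7): `stepEQAFB_kernel`, box edition). [folklore] -/
theorem step_95 : C25_2 = stepEQA D 2048 C25_1 (slices.getD 95 []) (hintsOfCodes Dr reps HC95) :=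
  stepEQAFB_kernel 6 13 7 rfl (by decide +kernel)


end CARPolyWindow.TierP.S2Rm2u
end Summit.Ventures.CertifiedManyBodySolver
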